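import Summits.CriticalPhenomena.PercolationContinuityZ3.Theorems.PercNearOneGluingNoHeavyQuantTorqueCost
import HarnessLib

/-!
# QUANT lane R8, T-DEC: FIXED-ROUTE TORQUE CERTIFICATES — the torque-cost criterion with zero, one or two prescribed routes whose gates are
# at most `T/6` (arm-1 gen 54, architect)

builds on p205010 (kernel theorem, internal audit signed; external expert review pending)

Support file (`--supports stmt-CriticalPhenomena-4575`), QUANT lane seat prim-quant-arm-1 (gen 54, architect); memo
`run/shared/lean/prim/quant/prim-quant-arm-1-g54/ARCH-G54.md` §1.  Theorems only, standard axioms, no sorries.  A thin, reusable layer over arm-1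
g50's torque-cost criterion `LawDec.decAt_all_of_torqueCost` / `LawDec.freeRate` (`…QuantTorqueCost`): when a law on `{0..M}` with mean `T`
(`2 < T ≤ 4`, resp. `4 < T ≤ 6`) has its positive low atoms `1` (resp. `1, 2`) shipped through ONE prescribed route each, the criterion's five
hypotheses collapse to one capacity inequality per route and one cost inequality; and when every route gate `max(y, (T−2l)/(h−l))` is at most
`T/6` (automatic for a floor `y ≤ T/6`, i.e. `6y ≤ T` — the criterion's own top-affordability at `M = 6`), the rate is at most `T/(6−T)`, the
capacity inequality becomes the POLYNOMIAL inequality `T·(μ_l + μ_h) ≤ 6·μ_h` and the cost inequality becomes `(h − T)·T ≤ (T − 1)(6 − T)`.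
Consumed by `…QuantSymTripleTwoChain` (the three-2-chains instance); written for general `M` so that other seven-atom (and wider, after the
obvious re-scaling) certificates can reuse it.

* `freeRate_le_sixth` (`6y ≤ T`, `6ρ ≤ T`, `T < 6` ⟹ `freeRate ≤ T/(6−T)`), `route_cap6`, `scale_cap6`, `route_cost6`, `route_cost_ineq`;
* `sum_freeRate_route`, `sum_route_row`, `budget_ge_one` (bookkeeping of one prescribed route inside the criterion's sums);
* **`decAt_all_of_noPosLow`** (`T ≤ 2`), **`decAt_all_of_oneRoute`** (`2 < T ≤ 4`, route `1 → h₁`), **`decAt_all_of_twoRoutes`** (`4 < T ≤ 6`,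
  routes `1 → h₁`, `2 → h₂`, `h₂ ≤ T`): DEC at every layer below the top.

HONEST STATUS.  Pure bookkeeping; `SiblingStep`, `GateStepN`, `LightResidDECOracle`, `FarTreeRow` OPEN; RATE class (log\*) / honest sentence of
`run/shared/lean/prim/quant/README.md` unchanged.  [this work].  Nothing here is cited as a published result.  The gluing rows served
[cite: KozmaNitzan2024, Conjecture 3 (p. 15)]; product measure [cite: Grimmett1999, §1.3 p. 10].
-/

noncomputable section

open scoped BigOperators

namespace Summit.CriticalPhenomena.PercolationContinuityZ3.Theorems
namespace Quant
namespace LawDec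

open Finset

/-! ### Route bookkeeping at gates at most `T/6` -/

/-- **if both branches of the route gate are at most `T/6 < 1`, the layer-free rate is at most `T/(6−T)`** (`t ↦ t/(1−t)` is monotone).
[this work] -/
theorem freeRate_le_sixth (y T : ℝ) (l h : ℕ) (hy : 6 * y ≤ T) (hr : 6 * ((T - 2 * (l : ℝ)) / ((h : ℝ) - l)) ≤ T) (hT6 : T < 6) :
    freeRate y T l h ≤ T / (6 - T) := by
  unfold freeRate
  set γ := max y ((T - 2 * (l : ℝ)) / ((h : ℝ) - l)) with hγ
  have hγT : 6 * γ ≤ T := by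
    rcases le_total y ((T - 2 * (l : ℝ)) / ((h : ℝ) - l)) with hle | hle
    · rw [hγ, max_eq_right hle]; exact hr
    · rw [hγ, max_eq_left hle]; exact hy
  have h1 : 0 < 1 - γ := by linarith
  have h6 : 0 < 6 - T := by linarith
  rw [div_le_iff₀ h1]
  have e : T / (6 - T) * (1 - γ) = T * (1 - γ) / (6 - T) := by ring
  rw [e, le_div_iff₀ h6]
  nlinarith

/-- **capacity of a route at rate `≤ T/(6−T)`**: `T·(A + B) ≤ 6B` ⟹ `κ·A ≤ B`. [this work] -/
theorem route_cap6 (κ T A B : ℝ) (hκ : κ ≤ T / (6 - T)) (hT6 : T < 6) (hA : 0 ≤ A) (hcap : T * (A + B) ≤ 6 * B) : κ * A ≤ B := by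
  have h6 : 0 < 6 - T := by linarith
  have h1 : T / (6 - T) * A ≤ B := by
    rw [div_mul_eq_mul_div, div_le_iff₀ h6]; nlinarith
  exact le_trans (mul_le_mul_of_nonneg_right hκ hA) h1

/-- **torque cost of a route at rate `≤ T/(6−T)` into `H ≥ T`**: `(H−T)·T ≤ (T−1)(6−T)` ⟹ `(H − T)·κ·m ≤ m·(T−1)`. [this work] -/
theorem route_cost6 (κ T H m : ℝ) (hκ : κ ≤ T / (6 - T)) (hT6 : T < 6) (hm : 0 ≤ m) (hTH : T ≤ H)
    (hineq : (H - T) * T ≤ (T - 1) * (6 - T)) : (H - T) * (κ * m) ≤ m * (T - 1) := by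
  have h6 : 0 < 6 - T := by linarith
  have h1 : (H - T) * κ ≤ T - 1 := by
    calc (H - T) * κ ≤ (H - T) * (T / (6 - T)) := mul_le_mul_of_nonneg_left hκ (by linarith)
      _ = (H - T) * T / (6 - T) := by rw [mul_div_assoc]
      _ ≤ T - 1 := by rw [div_le_iff₀ h6]; linarith
  calc (H - T) * (κ * m) = ((H - T) * κ) * m := by ring
    _ ≤ (T - 1) * m := mul_le_mul_of_nonneg_right h1 hm
    _ = m * (T - 1) := by ring

/-- scaling a `T/6`-capacity inequality by the outer gate `a ≥ 0`. [this work] -/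
theorem scale_cap6 (a T A B : ℝ) (ha : 0 ≤ a) (h : T * (A + B) ≤ 6 * B) : T * (a * A + a * B) ≤ 6 * (a * B) := by
  have h' := mul_le_mul_of_nonneg_left h ha
  calc T * (a * A + a * B) = a * (T * (A + B)) := by ring
    _ ≤ a * (6 * B) := h'
    _ = 6 * (a * B) := by ring

/-- the cost inequality of a route into `H`: `6 ≤ (7 − H)·T` ⟹ `(H − T)·T ≤ (T − 1)(6 − T)`. [this work] -/
theorem route_cost_ineq (T H : ℝ) (h : 6 ≤ (7 - H) * T) : (H - T) * T ≤ (T - 1) * (6 - T) := by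
  have e : (T - 1) * (6 - T) - (H - T) * T = (7 - H) * T - 6 := by ring
  linarith


/-- the load of one fixed route `l₀ → h₀` carrying the mass `m`, seen from the absorber `h`. [this work] -/
theorem sum_freeRate_route (y T m : ℝ) (M l₀ h₀ : ℕ) (hl₀ : l₀ ≤ M) (h : ℕ) :
    ∑ l ∈ Finset.range (M + 1), freeRate y T l h * (if l = l₀ ∧ h = h₀ then m else 0)
      = if h = h₀ then freeRate y T l₀ h₀ * m else 0 := by
  rw [Finset.sum_eq_single l₀]
  · by_cases hh : h = h₀
    · subst hh; simp
    · simp [hh]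
  · intro l _ hl; simp [hl]
  · intro hm; exact absurd (Finset.mem_range.2 (by omega)) hm

/-- the row of one fixed route `l₀ → h₀` carrying the mass `m`, seen from the low atom `l`. [this work] -/
theorem sum_route_row (m : ℝ) (M l₀ h₀ : ℕ) (hh₀ : h₀ ≤ M) (l : ℕ) :
    ∑ h ∈ Finset.range (M + 1), (if l = l₀ ∧ h = h₀ then m else 0) = if l = l₀ then m else 0 := by
  rw [Finset.sum_eq_single h₀]
  · by_cases hl : l = l₀
    · subst hl; simp
    · simp [hl]
  · intro h _ hh; simp [hh]
  · intro hm; exact absurd (Finset.mem_range.2 (by omega)) hm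

/-- the torque budget of the positive lows is at least its `l = 1` term (`1 < T`, all terms nonnegative). [this work] -/
theorem budget_ge_one (M : ℕ) (μ : ℕ → ℝ) (T : ℝ) (hμ0 : ∀ h, 0 ≤ μ h) (hM : 1 ≤ M) (hT1 : 1 < T) :
    μ 1 * (T - 1) ≤ ∑ l ∈ Finset.range (M + 1), (if (1 ≤ l ∧ (l : ℝ) < T) then μ l * (T - l) else 0) := by
  have h1mem : 1 ∈ Finset.range (M + 1) := Finset.mem_range.2 (by omega)
  refine le_trans ?_ (Finset.single_le_sum (f := fun l : ℕ => if (1 ≤ l ∧ (l : ℝ) < T) then μ l * (T - l) else 0)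
    (fun l _ => ?_) h1mem)
  · simp only [le_refl, Nat.cast_one, true_and]
    rw [if_pos hT1]
  · split_ifs with hc
    · exact mul_nonneg (hμ0 l) (by linarith [hc.2])
    · exact le_rfl

/-! ### The torque-cost criterion with zero, one or two fixed routes -/

/-- **no positive low atom (`T ≤ 2`): DEC at every layer** (the zero atom alone rides the torque; `decAt_all_of_torqueCost` with the empty
transport). [this work] -/
theorem decAt_all_of_noPosLow (y : ℝ) (M : ℕ) (μ : ℕ → ℝ) (T : ℝ) (hy0 : 0 < y) (hy1 : y < 1)
    (hμ0 : ∀ h, 0 ≤ μ h) (hμM : ∀ h, M < h → μ h = 0) (hμ1 : ∑ h ∈ Finset.range (M + 1), μ h = 1)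
    (hT : ∑ h ∈ Finset.range (M + 1), (h : ℝ) * μ h = T) (hT0 : 0 < T) (hT2 : T ≤ 2) (hta : y * (M : ℝ) ≤ T) :
    ∀ j', j' < M → DECAt y j' M μ := by
  refine decAt_all_of_torqueCost y M μ T (fun _ _ => 0) hy0 hy1 hμ0 hμM hμ1 hT hT0 hta (fun _ _ => le_rfl)
    (fun l h hf => absurd hf (lt_irrefl 0)) (fun l hl hlow => ?_) (fun h _ => ?_) ?_
  · exfalso
    have : (1 : ℝ) ≤ l := by exact_mod_cast hl
    linarith
  · simp only [mul_zero, Finset.sum_const_zero]; exact hμ0 h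
  · simp only [mul_zero, Finset.sum_const_zero, ite_self]
    refine Finset.sum_nonneg fun l _ => ?_
    split_ifs with hc
    · exact mul_nonneg (hμ0 l) (by linarith [hc.2])
    · exact le_rfl

/-- **ONE FIXED ROUTE (`2 < T ≤ 4`, the positive low `1` shipped to `h₁`)**: capacity `freeRate·μ 1 ≤ μ h₁` and (if `h₁ > T`) cost
`(h₁ − T)·freeRate·μ 1 ≤ μ 1·(T − 1)` ⟹ DEC at every layer. [this work] -/
theorem decAt_all_of_oneRoute (y : ℝ) (M h₁ : ℕ) (μ : ℕ → ℝ) (T : ℝ) (hy0 : 0 < y) (hy1 : y < 1)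
    (hμ0 : ∀ h, 0 ≤ μ h) (hμM : ∀ h, M < h → μ h = 0) (hμ1 : ∑ h ∈ Finset.range (M + 1), μ h = 1)
    (hT : ∑ h ∈ Finset.range (M + 1), (h : ℝ) * μ h = T) (hT2 : 2 < T) (hT4 : T ≤ 4) (hta : y * (M : ℝ) ≤ T)
    (hh₁ : 1 < h₁) (hh₁M : h₁ ≤ M) (hcomp : T < 1 + (h₁ : ℝ))
    (hcap : freeRate y T 1 h₁ * μ 1 ≤ μ h₁)
    (hcost : T < (h₁ : ℝ) → ((h₁ : ℝ) - T) * (freeRate y T 1 h₁ * μ 1) ≤ μ 1 * (T - 1)) :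
    ∀ j', j' < M → DECAt y j' M μ := by
  have hT0 : 0 < T := by linarith
  have hin : ∀ h, ∑ l ∈ Finset.range (M + 1), freeRate y T l h * (if l = 1 ∧ h = h₁ then μ 1 else 0)
      = if h = h₁ then freeRate y T 1 h₁ * μ 1 else 0 := fun h => sum_freeRate_route y T (μ 1) M 1 h₁ (by omega) h
  refine decAt_all_of_torqueCost y M μ T (fun l h => if l = 1 ∧ h = h₁ then μ 1 else 0) hy0 hy1 hμ0 hμM hμ1 hT hT0 hta
    ?_ ?_ ?_ ?_ ?_
  · intro l h; split_ifs; exacts [hμ0 1, le_rfl]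
  · intro l h hpos
    split_ifs at hpos with hc
    · obtain ⟨rfl, rfl⟩ := hc
      exact ⟨le_rfl, by push_cast; linarith, hh₁, hh₁M, by push_cast; linarith⟩
    · exact absurd hpos (lt_irrefl 0)
  · intro l hl hlow
    rw [sum_route_row (μ 1) M 1 h₁ hh₁M l]
    by_cases hl1 : l = 1
    · subst hl1; rw [if_pos rfl]
    · exfalso
      have : (2 : ℝ) ≤ l := by exact_mod_cast (show 2 ≤ l by omega)
      linarith
  · intro h _
    rw [hin h]
    split_ifs with hh
    · rw [hh]; exact hcap
    · exact hμ0 h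
  · have hL : ∑ h ∈ Finset.range (M + 1), (if T < (h : ℝ) then ((h : ℝ) - T) *
        ∑ l ∈ Finset.range (M + 1), freeRate y T l h * (if l = 1 ∧ h = h₁ then μ 1 else 0) else 0)
        = if T < (h₁ : ℝ) then ((h₁ : ℝ) - T) * (freeRate y T 1 h₁ * μ 1) else 0 := by
      rw [Finset.sum_eq_single h₁]
      · rw [hin h₁, if_pos rfl]
      · intro h _ hh
        rw [hin h, if_neg hh, mul_zero, ite_self]
      · intro hm; exact absurd (Finset.mem_range.2 (by omega)) hm
    rw [hL]
    have hR := budget_ge_one M μ T hμ0 (by omega) (by linarith)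
    split_ifs with hc
    · exact (hcost hc).trans hR
    · exact le_trans (mul_nonneg (hμ0 1) (by linarith)) hR

/-- **TWO FIXED ROUTES (`4 < T ≤ 6`, the positive lows `1 → h₁` and `2 → h₂`, `h₁ ≠ h₂`, `h₂ ≤ T` costless)**: the two capacities and the cost
of the first route ⟹ DEC at every layer. [this work] -/
theorem decAt_all_of_twoRoutes (y : ℝ) (M h₁ h₂ : ℕ) (μ : ℕ → ℝ) (T : ℝ) (hy0 : 0 < y) (hy1 : y < 1)
    (hμ0 : ∀ h, 0 ≤ μ h) (hμM : ∀ h, M < h → μ h = 0) (hμ1 : ∑ h ∈ Finset.range (M + 1), μ h = 1)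
    (hT : ∑ h ∈ Finset.range (M + 1), (h : ℝ) * μ h = T) (hT4 : 4 < T) (hT6 : T ≤ 6) (hta : y * (M : ℝ) ≤ T)
    (hh₁ : 1 < h₁) (hh₁M : h₁ ≤ M) (hcomp₁ : T < 1 + (h₁ : ℝ))
    (hh₂ : 2 < h₂) (hh₂M : h₂ ≤ M) (hcomp₂ : T < 2 + (h₂ : ℝ)) (hh₂T : (h₂ : ℝ) ≤ T) (hne : h₁ ≠ h₂)
    (hcap₁ : freeRate y T 1 h₁ * μ 1 ≤ μ h₁) (hcap₂ : freeRate y T 2 h₂ * μ 2 ≤ μ h₂)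
    (hcost : T < (h₁ : ℝ) → ((h₁ : ℝ) - T) * (freeRate y T 1 h₁ * μ 1) ≤ μ 1 * (T - 1)) :
    ∀ j', j' < M → DECAt y j' M μ := by
  have hT0 : 0 < T := by linarith
  have hin : ∀ h, ∑ l ∈ Finset.range (M + 1), freeRate y T l h *
      ((if l = 1 ∧ h = h₁ then μ 1 else 0) + (if l = 2 ∧ h = h₂ then μ 2 else 0))
      = (if h = h₁ then freeRate y T 1 h₁ * μ 1 else 0) + (if h = h₂ then freeRate y T 2 h₂ * μ 2 else 0) := by
    intro h
    simp only [mul_add, Finset.sum_add_distrib]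
    rw [sum_freeRate_route y T (μ 1) M 1 h₁ (by omega) h, sum_freeRate_route y T (μ 2) M 2 h₂ (by omega) h]
  refine decAt_all_of_torqueCost y M μ T
    (fun l h => (if l = 1 ∧ h = h₁ then μ 1 else 0) + (if l = 2 ∧ h = h₂ then μ 2 else 0)) hy0 hy1 hμ0 hμM hμ1 hT hT0 hta
    ?_ ?_ ?_ ?_ ?_
  · intro l h
    refine add_nonneg ?_ ?_ <;> split_ifs
    exacts [hμ0 1, le_rfl, hμ0 2, le_rfl]
  · intro l h hpos
    by_cases hc : l = 1 ∧ h = h₁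
    · obtain ⟨rfl, rfl⟩ := hc
      exact ⟨le_rfl, by push_cast; linarith, hh₁, hh₁M, by push_cast; linarith⟩
    by_cases hc' : l = 2 ∧ h = h₂
    · obtain ⟨rfl, rfl⟩ := hc'
      exact ⟨by norm_num, by push_cast; linarith, hh₂, hh₂M, by push_cast; linarith⟩
    rw [if_neg hc, if_neg hc', add_zero] at hpos
    exact absurd hpos (lt_irrefl 0)
  · intro l hl hlow
    rw [Finset.sum_add_distrib, sum_route_row (μ 1) M 1 h₁ hh₁M l, sum_route_row (μ 2) M 2 h₂ hh₂M l]
    by_cases hl1 : l = 1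
    · subst hl1; norm_num
    by_cases hl2 : l = 2
    · subst hl2; norm_num
    exfalso
    have : (3 : ℝ) ≤ l := by exact_mod_cast (show 3 ≤ l by omega)
    linarith
  · intro h _
    rw [hin h]
    by_cases hh : h = h₁
    · subst hh; rw [if_pos rfl, if_neg hne, add_zero]; exact hcap₁
    by_cases hh' : h = h₂
    · subst hh'; rw [if_neg hh, if_pos rfl, zero_add]; exact hcap₂
    rw [if_neg hh, if_neg hh', add_zero]; exact hμ0 h
  · have hL : ∑ h ∈ Finset.range (M + 1), (if T < (h : ℝ) then ((h : ℝ) - T) *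
        ∑ l ∈ Finset.range (M + 1), freeRate y T l h *
          ((if l = 1 ∧ h = h₁ then μ 1 else 0) + (if l = 2 ∧ h = h₂ then μ 2 else 0)) else 0)
        = if T < (h₁ : ℝ) then ((h₁ : ℝ) - T) * (freeRate y T 1 h₁ * μ 1) else 0 := by
      rw [Finset.sum_eq_single h₁]
      · rw [hin h₁, if_pos rfl, if_neg hne, add_zero]
      · intro h _ hh
        rw [hin h, if_neg hh, zero_add]
        by_cases hh' : h = h₂
        · subst hh'; rw [if_neg (not_lt.2 hh₂T)]
        · rw [if_neg hh', mul_zero, ite_self]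
      · intro hm; exact absurd (Finset.mem_range.2 (by omega)) hm
    rw [hL]
    have hR := budget_ge_one M μ T hμ0 (by omega) (by linarith)
    split_ifs with hc
    · exact (hcost hc).trans hR
    · exact le_trans (mul_nonneg (hμ0 1) (by linarith)) hR

end LawDec
end Quant
end Summit.CriticalPhenomena.PercolationContinuityZ3.Theorems
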